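import Literature.Barriers.ValiantsHypothesis.FullRankMultilinearFormulaDecomposition
import HarnessLib

/-!
# Log-products: the iterated decomposition of a syntactically multilinear formula
(Raz 2006 §3.2 / Lemma 3.3 mechanism; roadmap step (a3) towards the multilinear-formula slice)

Continuation of `FullRankMultilinearFormulaDecomposition.lean` (`decomp t e`: one level).  Along an
ADMISSIBLE list of thresholds `t₁ > t₂ > …` (`t_{j+1} ≤ t_j / 2`, all `≥ 1`) we decompose at
`t₁`, then inside every GOOD sub-formula at `t₂`, and so on (`decompIter`); a term is a
sub-formula `g` with its chain of cofactors `(A_j, V_j)`, `A_j ∈ K[V_j]`, and its value is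
`g · ∏_j A_j` (`termEval`).

* `sum_decompIter` — `e.eval = Σ_terms g.eval · ∏_j A_j`;
* `sum_size_decomp_le`, `length_decompIter_le` — at most `|Φ| + 1` terms, whatever the depth;
* `decompIter_spec` — for syntactically multilinear `e`: the sets `varSet g, V₁, …, V_m` are
  pairwise disjoint subsets of `varSet e`, and every term is EITHER FULL (one cofactor per level
  with the annulus bounds `|V_j| ≥ t_{j-1} − 2 t_j − uncovered`) OR a REMAINDER (more than
  `min_j t_j` variables of `e` uncovered).  With `AKV.rank_cm_prod_le`
  (`FullRankMultilinearProductRank.lean`) a term has `rank M_{Y,Z} ≤ 2^{(covered)/2 − Σ_j imbalance_j}`,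
  so only FULL terms balanced at every level within `D` and leaving `≤ 2D` variables uncovered can
  reach rank `2^{u−D}`; `RazCut.card_balanced_windows_le` (`FullRankMultilinearCutCounting.lean`)
  bounds the number of balanced cuts for which that happens.  The remaining assembly (roadmap (a4):
  union bound over the `≤ |Φ|+1` terms against full rank) is NOT in this file.

## References
* [Raz2006] R. Raz, *Separation of multilinear circuit and formula size*, Theory of Computing 2
  (2006) 121–135, §3.2, Lemma 3.3, §4.
-/

noncomputable section

namespace Literature.Barriers.ValiantsHypothesis.RazFormula

open MvPolynomial Finset Literature.Computability.AlgebraicComplexity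
open Literature.Computability.AlgebraicComplexity.WExpr

universe u v

variable {k : Type u} {σ : Type v} [DecidableEq σ] [CommSemiring k]

/-! ### Terms and the iterated decomposition -/

section LogProduct

/-- The value of a term `(g, [(A₁,V₁),…,(A_m,V_m)])`: `g.eval · ∏ A_j`. [cite: Raz2006, §3.2] -/
def termEval (q : WExpr k σ × List (MvPolynomial σ k × Finset σ)) : MvPolynomial σ k :=
  q.1.eval * (q.2.map Prod.fst).prod

/-- **Iterated decomposition along a list of thresholds** `t₁ > t₂ > …`: decompose at `t₁`; inside
every GOOD term (`t₁ < |varSet g|`) decompose `g` at `t₂`, and so on; REMAINDER terms stop.  Each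
term carries its chain of cofactors with their declared variable sets. [cite: Raz2006, §3.2] -/
def decompIter : List ℕ → WExpr k σ → List (WExpr k σ × List (MvPolynomial σ k × Finset σ))
  | [], e => [(e, [])]
  | t :: ts, e => (decomp t e).flatMap fun p =>
      if t < (varSet p.1).card then (decompIter ts p.1).map fun q => (q.1, (p.2.1, p.2.2) :: q.2)
      else [(p.1, [(p.2.1, p.2.2)])]

omit [DecidableEq σ] in
/-- Sum over a `flatMap`, blockwise. [folklore] -/
private theorem sum_map_flatMap {α β : Type*} (L : List α) (f : α → List β) (g : β → MvPolynomial σ k) :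
    ((L.flatMap f).map g).sum = (L.map fun a => ((f a).map g).sum).sum := by
  induction L with
  | nil => simp
  | cons a L ih => simp [List.flatMap_cons, ih]

omit [DecidableEq σ] [CommSemiring k] in
/-- Length of a `flatMap`, blockwise. [folklore] -/
private theorem length_flatMap_eq {α β : Type*} (L : List α) (f : α → List β) :
    (L.flatMap f).length = (L.map fun a => (f a).length).sum := by
  induction L with
  | nil => simp
  | cons a L ih => simp [List.flatMap_cons, ih]

/-- **The iterated decomposition computes the formula**: `e.eval = Σ_terms g.eval · ∏_j A_j`.
[cite: Raz2006, §3.2] -/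
theorem sum_decompIter (ts : List ℕ) (e : WExpr k σ) :
    ((decompIter ts e).map termEval).sum = e.eval := by
  induction ts generalizing e with
  | nil => simp [decompIter, termEval]
  | cons t ts ih =>
    simp only [decompIter]
    rw [sum_map_flatMap, ← sum_decomp t e]
    congr 1
    refine List.map_congr_left fun p _ => ?_
    split_ifs with hgood
    · rw [List.map_map]
      have : ((decompIter ts p.1).map (termEval ∘ fun q => (q.1, (p.2.1, p.2.2) :: q.2))).sum =
          ((decompIter ts p.1).map termEval).sum * p.2.1 := by
        rw [← List.sum_map_mul_right]
        congr 1
        refine List.map_congr_left fun q _ => ?_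
        simp only [Function.comp_apply, termEval, List.map_cons, List.prod_cons]
        ring
      rw [this, ih]
    · simp [termEval]

/-- The sub-formulas returned by one level are disjoint subtrees: `Σ (|g| + 1) ≤ |e| + 1`.
[cite: Raz2006, §3.2] -/
theorem sum_size_decomp_le (t : ℕ) (e : WExpr k σ) :
    ((decomp t e).map fun p => p.1.size + 1).sum ≤ e.size + 1 := by
  induction e with
  | var i => simp [decomp]
  | const c => simp [decomp]
  | lin c₁ e₁ c₂ e₂ ih₁ ih₂ =>
    simp only [decomp]
    split_ifs
    · simp
    · rw [List.map_append, List.sum_append, List.map_map, List.map_map, size_lin]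
      have h1 : ((decomp t e₁).map ((fun p => p.1.size + 1) ∘ fun p => (p.1, c₁ • p.2.1, p.2.2))).sum =
          ((decomp t e₁).map fun p => p.1.size + 1).sum := by
        congr 1
      have h2 : ((decomp t e₂).map ((fun p => p.1.size + 1) ∘ fun p => (p.1, c₂ • p.2.1, p.2.2))).sum =
          ((decomp t e₂).map fun p => p.1.size + 1).sum := by
        congr 1
      rw [h1, h2]; omega
  | mul e₁ e₂ ih₁ ih₂ =>
    simp only [decomp]
    split_ifs
    · simp
    · rw [List.map_map, size_mul]
      have h1 : ((decomp t e₁).map ((fun p => p.1.size + 1) ∘ fun p => (p.1, p.2.1 * e₂.eval, p.2.2 ∪ varSet e₂))).sum =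
          ((decomp t e₁).map fun p => p.1.size + 1).sum := by
        congr 1
      rw [h1]; omega
    · rw [List.map_map, size_mul]
      have h2 : ((decomp t e₂).map ((fun p => p.1.size + 1) ∘ fun p => (p.1, p.2.1 * e₁.eval, p.2.2 ∪ varSet e₁))).sum =
          ((decomp t e₂).map fun p => p.1.size + 1).sum := by
        congr 1
      rw [h2]; omega

/-- **At most `|Φ| + 1` terms after any number of levels** (each term is indexed by a distinct
node of the formula). [cite: Raz2006, §3.2] -/
theorem length_decompIter_le (ts : List ℕ) (e : WExpr k σ) : (decompIter ts e).length ≤ e.size + 1 := by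
  induction ts generalizing e with
  | nil => simp [decompIter]
  | cons t ts ih =>
    simp only [decompIter]
    rw [length_flatMap_eq]
    refine le_trans ?_ (sum_size_decomp_le t e)
    -- termwise comparison of the two sums over `decomp t e`
    induction decomp t e with
    | nil => simp
    | cons p L ihL =>
      rw [List.map_cons, List.map_cons, List.sum_cons, List.sum_cons]
      refine Nat.add_le_add ?_ ihL
      split_ifs
      · rw [List.length_map]; exact ih p.1
      · simp

/-- Thresholds are ADMISSIBLE if all are `≥ 1` and each is at most half of its predecessor
(so that a GOOD sub-formula at one level, `t < |varSet g|`, is large at the next, `2t' < |varSet g|`).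
[cite: Raz2006, §3.2] -/
def Admissible : List ℕ → Prop
  | [] => True
  | [t] => 1 ≤ t
  | t :: t' :: ts => 1 ≤ t ∧ 2 * t' ≤ t ∧ Admissible (t' :: ts)

omit [DecidableEq σ] [CommSemiring k] in
/-- Unfolding of `Admissible` on a cons. [folklore] -/
private theorem admissible_cons {t : ℕ} {ts : List ℕ} (h : Admissible (t :: ts)) :
    1 ≤ t ∧ Admissible ts ∧ ∀ t' ∈ ts.head?, 2 * t' ≤ t := by
  cases ts with
  | nil => exact ⟨h, trivial, by simp⟩
  | cons t' ts => exact ⟨h.1, h.2.2, by simpa using h.2.1⟩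

/-- The annulus lower bounds along a chain of thresholds: level `j` (threshold `t_j`, previous
threshold `t_{j-1}`, `t_0 := p`) has at least `t_{j-1} - 2 t_j` variables between the two
sub-formulas. [cite: Raz2006, §3.2] -/
def lows : ℕ → List ℕ → List ℕ
  | _, [] => []
  | p, t :: ts => (p - 2 * t) :: lows t ts

/-- **Specification of the iterated decomposition** (syntactically multilinear `e`, admissible
thresholds `t₁ > t₂ > …` with `2t₁ < |varSet e|`, and a bookkeeping parameter `p ≤ |varSet e|`,
"the previous threshold").  Every term `(g, [(A₁,V₁),…,(A_m,V_m)])` has: `g` syntactically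
multilinear, `varSet g ⊆ varSet e`; `A_j ∈ K[V_j]`, `V_j ⊆ varSet e`, `V_j ∩ varSet g = ∅`; the `V_j`
pairwise disjoint; the covered variables `|varSet g| + Σ_j |V_j| ≤ |varSet e|`; and EITHER the term
is FULL — one cofactor per level and, for every level `j`, the annulus bound
`(t_{j-1} - 2 t_j) + covered ≤ |V_j| + |varSet e|` (i.e. `|V_j| ≥ t_{j-1} - 2t_j - uncovered`,
`t_0 := p`) — OR a REMAINDER: `covered + t < |varSet e|` for some threshold `t` of the list.
A FULL term leaving `≤ 2D` variables uncovered thus has `m` pairwise disjoint cofactor sets of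
sizes `≥ t_{j-1} - 2 t_j - 2D`; a REMAINDER leaves `> min_j t_j` variables uncovered.
[cite: Raz2006, §3.2 and Lemma 3.3] -/
theorem decompIter_spec :
    ∀ (ts : List ℕ) {e : WExpr k σ} (p : ℕ), Admissible ts → IsSyntMultilinear e →
      (∀ t ∈ ts.head?, 2 * t < (varSet e).card) → p ≤ (varSet e).card →
      ∀ {g : WExpr k σ} {As : List (MvPolynomial σ k × Finset σ)}, (g, As) ∈ decompIter ts e →
        (IsSyntMultilinear g ∧ varSet g ⊆ varSet e) ∧
        (∀ q ∈ As, q.1 ∈ supported k (↑q.2 : Set σ) ∧ q.2 ⊆ varSet e ∧ Disjoint q.2 (varSet g)) ∧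
        (As.map Prod.snd).Pairwise Disjoint ∧
        (varSet g).card + (As.map fun q => q.2.card).sum ≤ (varSet e).card ∧
        ((As.length = ts.length ∧
            ∀ q L, (q, L) ∈ As.zip (lows p ts) →
              L + (varSet g).card + (As.map fun q => q.2.card).sum ≤ q.2.card + (varSet e).card) ∨
          ∃ t ∈ ts, (varSet g).card + (As.map fun q => q.2.card).sum + t < (varSet e).card) := by
  intro ts
  induction ts with
  | nil =>
    intro e p _ he _ _ g As hmem
    simp only [decompIter, List.mem_singleton, Prod.mk.injEq] at hmem
    obtain ⟨rfl, rfl⟩ := hmem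
    refine ⟨⟨he, subset_refl _⟩, by simp, List.Pairwise.nil, by simp, Or.inl ⟨rfl, ?_⟩⟩
    intro q L h
    simp [lows] at h
  | cons t ts ih =>
    intro e p hadm he hlarge hp g As hmem
    obtain ⟨ht1, hadm', hhead⟩ := admissible_cons hadm
    have hlt : 2 * t < (varSet e).card := hlarge t (by simp)
    simp only [decompIter, List.mem_flatMap] at hmem
    obtain ⟨⟨g₁, A₁, V₁⟩, hp₁, hmem⟩ := hmem
    obtain ⟨hg₁, hsub₁, hcard₁, hA₁, hV₁, hdisj₁, hdich₁⟩ := decomp_spec ht1 he hlt hp₁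
    -- `V₁` and `varSet g₁` are disjoint inside `varSet e`
    have hVg₁ : V₁.card + (varSet g₁).card ≤ (varSet e).card := by
      rw [← card_union_of_disjoint hdisj₁]
      exact card_le_card (union_subset hV₁ hsub₁)
    by_cases hgood : t < (varSet g₁).card
    · rw [if_pos hgood, List.mem_map] at hmem
      obtain ⟨⟨g', As'⟩, hmem', hEq⟩ := hmem
      simp only [Prod.mk.injEq] at hEq
      obtain ⟨rfl, rfl⟩ := hEq
      have hlarge' : ∀ t' ∈ ts.head?, 2 * t' < (varSet g₁).card :=
        fun t' ht' => lt_of_le_of_lt (hhead t' ht') hgood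
      obtain ⟨⟨hg, hsub⟩, hAs, hpw, hcov, hdich⟩ := ih t hadm' hg₁ hlarge' hgood.le hmem'
      have hsum : (((A₁, V₁) :: As').map fun q => q.2.card).sum =
          V₁.card + (As'.map fun q => q.2.card).sum := by
        rw [List.map_cons, List.sum_cons]
      refine ⟨⟨hg, hsub.trans hsub₁⟩, ?_, ?_, ?_, ?_⟩
      · intro q hq
        rw [List.mem_cons] at hq
        rcases hq with rfl | hq
        · exact ⟨hA₁, hV₁, hdisj₁.mono_right hsub⟩
        · obtain ⟨h1, h2, h3⟩ := hAs q hq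
          exact ⟨h1, h2.trans hsub₁, h3⟩
      · rw [List.map_cons, List.pairwise_cons]
        refine ⟨fun V hV => ?_, hpw⟩
        obtain ⟨q, hq, rfl⟩ := List.mem_map.1 hV
        exact hdisj₁.mono_right (hAs q hq).2.1
      · rw [hsum]; omega
      · rw [hsum]
        rcases hdich with ⟨hlen, hbd⟩ | ⟨t', ht', hrem⟩
        · left
          refine ⟨by rw [List.length_cons, hlen, List.length_cons], fun q L hqL => ?_⟩
          rw [lows, List.zip_cons_cons, List.mem_cons] at hqL
          rcases hqL with hqL | hqL
          · -- the new top level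
            simp only [Prod.mk.injEq] at hqL
            obtain ⟨rfl, rfl⟩ := hqL
            dsimp only
            have h2t : p - 2 * t + (varSet g₁).card ≤ (varSet e).card := by omega
            omega
          · have hb := hbd q L hqL
            omega
        · right
          exact ⟨t', List.mem_cons_of_mem _ ht', by omega⟩
    · rw [if_neg hgood, List.mem_singleton, Prod.mk.injEq] at hmem
      obtain ⟨rfl, rfl⟩ := hmem
      have hsum : ([(A₁, V₁)].map fun q => q.2.card).sum = V₁.card := by simp
      refine ⟨⟨hg₁, hsub₁⟩, ?_, ?_, ?_, Or.inr ⟨t, List.mem_cons_self, ?_⟩⟩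
      · intro q hq
        rw [List.mem_singleton] at hq
        subst hq
        exact ⟨hA₁, hV₁, hdisj₁⟩
      · simp
      · rw [hsum]; omega
      · rw [hsum]
        rcases hdich₁ with h | h
        · exact absurd h hgood
        · omega

end LogProduct

end Literature.Barriers.ValiantsHypothesis.RazFormula
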